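import Literature.Computability.AlgebraicComplexity.MatrixMultiplicationExponent
import Mathlib.Analysis.SpecialFunctions.Log.Base

/-!
# Coppersmith–Winograd 1990: the "easy" bound `ω ≤ log_q((4/27)·R(T_cw,q^{⊠k})^{3/k})`

Topic `Literature/Computability/AlgebraicComplexity` (route `MatrixMultiplication/AsymptoticRankCW`,
items `stmt-MatrixMultiplication-0588` thesis X_B, `-0589` assembly).

Named literature facts (Props, not proved here) recording the one theorem through which the small
Coppersmith–Winograd tensor
`T_cw,q = ∑_{j=1}^{q} (e₀⊗e_j⊗e_j + e_j⊗e₀⊗e_j + e_j⊗e_j⊗e₀) ∈ (ℂ^{q+1})^{⊗3}` bounds the exponent of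
matrix multiplication:

* Conner–Gesmundo–Landsberg–Ventura, comput. complexity 31 (2022) = arXiv:1909.04785, **Thm 1.1**
  (Coppersmith–Winograd [CW90]): for all `k` and `q`, `ω ≤ log_q((4/27) · bR(T_cw,q^{⊠k})^{3/k})`, `bR` the
  border rank, `⊠k` the `k`-th Kronecker power.
* ibid. p. 3: "[BCS97, Ex. 15.24] observes that Theorem 1.1 holds replacing `bR(T_cw,q^{⊠k})^{1/k}` with
  the asymptotic rank `R̃(T_cw,q)`. In particular, were `R̃(T_cw,2) = 3`, then Theorem 1.1 would imply
  `ω = 2`."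

To stay independent of the (pending) `cwTensor`/`kroneckerPow`/`borderRank`/`asymptoticRank` layers, the
Kronecker power `T_cw,q^{⊠N}` is written INLINE as the coordinate tensor on `(Fin N → Fin (q+1))³`
`fun a b c => ∏ i, [ (a i = 0 ∧ b i = c i ≠ 0) ∨ (b i = 0 ∧ a i = c i ≠ 0) ∨ (c i = 0 ∧ a i = b i ≠ 0) ]`
(exactly the term used in the route's signatures; it is `rfl`-equal to `kroneckerPow (cwTensor q) N` of the
pending definition files), and:

* `CoppersmithWinograd1990_rank_form` uses the RANK `R = tensorRank` in place of border rank — a corollary of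
  the printed Thm 1.1 since `bR ≤ R` and `x ↦ log_q((4/27)x^{3/k})` is monotone for `q ≥ 2` (weaker than
  print, never stronger);
* `CoppersmithWinograd1990_asymptoticRank_form` unfolds the hypothesis "`R̃(T_cw,q) ≤ ρ`" as the growth bound
  `∀ ε > 0, R(T_cw,q^{⊠N}) = O(ρ^{(1+ε)N})` (which implies `R̃ ≤ ρ`), concluding `ω ≤ log_q(4ρ³/27)`;
  for `q = 2, ρ = 3`: `ω ≤ log₂ 4 = 2` (`omega_le_two_of_cw_two`, proved from the fact).

Mathlib/Literature: no CW tensor, laser method or τ-theorem (searched `Coppersmith`, `laser`, `Schonhage`).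

## References
* D. Coppersmith, S. Winograd, *Matrix multiplication via arithmetic progressions*, J. Symbolic Comput. 9
  (1990) 251–280, §6 ("easy" construction).
* A. Conner, F. Gesmundo, J. M. Landsberg, E. Ventura, *Rank and border rank of Kronecker powers of tensors
  and Strassen's laser method*, comput. complexity 31 (2022), arXiv:1909.04785, Thm 1.1 and p. 3.
* P. Bürgisser, M. Clausen, M. A. Shokrollahi, *Algebraic Complexity Theory* (1997), Thm 15.41, Ex. 15.24.
* M. Bläser, *Fast Matrix Multiplication*, ToC Graduate Surveys 5 (2013), §9.2 (p. 47), Problem 9.8.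
-/

noncomputable section

open scoped BigOperators
open Filter Asymptotics

namespace Literature.Computability.AlgebraicComplexity

/-- **Coppersmith–Winograd 1990, rank form** (corollary of Conner–Gesmundo–Landsberg–Ventura 2022
Thm 1.1, which has border rank in place of rank): for all `q ≥ 2`, `k ≥ 1`,
`ω(ℂ) ≤ log_q((4/27) · R(T_cw,q^{⊠k})^{3/k})`, the Kronecker power of the small Coppersmith–Winograd
tensor being written inline on `(Fin k → Fin (q+1))³`. Named literature fact; users take
`(h : CoppersmithWinograd1990_rank_form)`. [cite: ConnerGesmundoLandsbergVentura2022, Thm 1.1] -/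
def CoppersmithWinograd1990_rank_form : Prop :=
  ∀ q k : ℕ, 2 ≤ q → 1 ≤ k →
    omega ℂ ≤ Real.logb q ((4 / 27) *
      ((tensorRank (K := ℂ) (fun a b c : Fin k → Fin (q + 1) => ∏ i,
        (if (a i = 0 ∧ b i = c i ∧ b i ≠ 0) ∨ (b i = 0 ∧ a i = c i ∧ a i ≠ 0) ∨
          (c i = 0 ∧ a i = b i ∧ a i ≠ 0) then (1 : ℂ) else 0)) : ℝ) ^ ((3 : ℝ) / k)))

/-- **Coppersmith–Winograd 1990, asymptotic-rank form** (BCS97 Ex. 15.24 as quoted by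
Conner–Gesmundo–Landsberg–Ventura 2022, p. 3: Thm 1.1 holds with `R̃(T_cw,q)` in place of
`bR(T_cw,q^{⊠k})^{1/k}`), with "`R̃(T_cw,q) ≤ ρ`" unfolded as a growth bound on the ranks of Kronecker
powers: for `q ≥ 2` and `ρ > 0`, if `R(T_cw,q^{⊠N}) = O(ρ^{(1+ε)N})` for every `ε > 0` then
`ω(ℂ) ≤ log_q(4ρ³/27)`. ("In particular, were `R̃(T_cw,2) = 3`, then Theorem 1.1 would imply `ω = 2`.")
Named literature fact. [cite: ConnerGesmundoLandsbergVentura2022, Thm 1.1 and p. 3 (BCS97 Ex. 15.24)] -/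
def CoppersmithWinograd1990_asymptoticRank_form : Prop :=
  ∀ q : ℕ, 2 ≤ q → ∀ ρ : ℝ, 0 < ρ →
    (∀ ε : ℝ, 0 < ε →
      (fun N : ℕ => (tensorRank (K := ℂ) (fun a b c : Fin N → Fin (q + 1) => ∏ i,
        (if (a i = 0 ∧ b i = c i ∧ b i ≠ 0) ∨ (b i = 0 ∧ a i = c i ∧ a i ≠ 0) ∨
          (c i = 0 ∧ a i = b i ∧ a i ≠ 0) then (1 : ℂ) else 0)) : ℝ)) =O[atTop]
        fun N : ℕ => ρ ^ ((1 + ε) * N)) →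
    omega ℂ ≤ Real.logb q (4 * ρ ^ 3 / 27)

/-- The numerology of the route: `log₂(4·3³/27) = 2`. [folklore] -/
theorem logb_two_cw_two : Real.logb 2 (4 * (3 : ℝ) ^ 3 / 27) = 2 := by
  rw [show (4 * (3 : ℝ) ^ 3 / 27) = 2 ^ (2 : ℕ) by norm_num, Real.logb_pow,
    Real.logb_self_eq_one (by norm_num)]
  norm_num

/-- How the route's assembly `X_B → ω(ℂ) ≤ 2` factors through the fact: specialise to `q = 2`,
`ρ = 3` (the hypothesis is literally the thesis `stmt-MatrixMultiplication-0588`); together with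
`2 ≤ ω(ℂ)` (flattening bound) this gives `ω(ℂ) = 2`. [cite: ConnerGesmundoLandsbergVentura2022, p. 3] -/
theorem omega_le_two_of_cw_two (h : CoppersmithWinograd1990_asymptoticRank_form)
    (hX : ∀ ε : ℝ, 0 < ε →
      (fun N : ℕ => (tensorRank (K := ℂ) (fun a b c : Fin N → Fin 3 => ∏ i,
        (if (a i = 0 ∧ b i = c i ∧ b i ≠ 0) ∨ (b i = 0 ∧ a i = c i ∧ a i ≠ 0) ∨
          (c i = 0 ∧ a i = b i ∧ a i ≠ 0) then (1 : ℂ) else 0)) : ℝ)) =O[atTop]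
        fun N : ℕ => (3 : ℝ) ^ ((1 + ε) * N)) :
    omega ℂ ≤ 2 := by
  have := h 2 le_rfl 3 (by norm_num) hX
  rwa [Nat.cast_ofNat, logb_two_cw_two] at this

/-- The assembly item `stmt-MatrixMultiplication-0589` modulo the fact and the lower frame `2 ≤ ω(ℂ)`
(`stmt-MatrixMultiplication-0586`): X_B ⇒ `MatrixMultiplication`. [cite: ConnerGesmundoLandsbergVentura2022, p. 3] -/
theorem matrixMultiplication_of_cw_two (h : CoppersmithWinograd1990_asymptoticRank_form)
    (hω : 2 ≤ omega ℂ)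
    (hX : ∀ ε : ℝ, 0 < ε →
      (fun N : ℕ => (tensorRank (K := ℂ) (fun a b c : Fin N → Fin 3 => ∏ i,
        (if (a i = 0 ∧ b i = c i ∧ b i ≠ 0) ∨ (b i = 0 ∧ a i = c i ∧ a i ≠ 0) ∨
          (c i = 0 ∧ a i = b i ∧ a i ≠ 0) then (1 : ℂ) else 0)) : ℝ)) =O[atTop]
        fun N : ℕ => (3 : ℝ) ^ ((1 + ε) * N)) :
    MatrixMultiplication :=
  le_antisymm (omega_le_two_of_cw_two h hX) hω

end Literature.Computability.AlgebraicComplexity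

end
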